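import Literature.Analysis.SpecialFunctions.GammaStirlingVertical
import Mathlib.Analysis.SpecialFunctions.Gamma.Deriv
import Mathlib.Analysis.SpecialFunctions.Gamma.Beta
import Mathlib.Analysis.Complex.ReImTopology
import HarnessLib

/-!
# The gamma factors `Δ^±(s)` of the Shintani functional equation (BTT Thm 2.4 (eq:FE)) and the
# Landau–Chandrasekharan–Narasimhan kernel `G^±(s) = 6Δ^±(s)/(Δ^±(1−s)(1−s)(2−s)(3−s)(4−s))`

Topic `Literature/NumberTheory/CubicFields` (the analytic side of Bhargava–Taniguchi–Thorne 2023, §§2.4–3).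
BTT p. 9 (before Thm 2.4): "we introduce a gamma factor `Δ(s) := diag(Δ⁺(s), Δ⁻(s))`, where
`Δ⁺(s) := (2⁴3⁶/π⁴)^{s/2} Γ(s/2) Γ(s/2 + 1/2) Γ(s/2 − 1/12) Γ(s/2 + 1/12)`,
`Δ⁻(s) := (2⁴3⁶/π⁴)^{s/2} Γ(s/2) Γ(s/2 + 1/2) Γ(s/2 + 5/12) Γ(s/2 + 7/12)`", the diagonalised
functional equation (eq:FE) being `Δ(1 − s)·T·ξ(1 − s, Φ_m) = m^{4s} diag(3, −3)·Δ(s)·T·ξ(s, Φ̂_m)`.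
The proof of Theorem 3.1 (p. 11, following [LDTT] §2.2) moves the line of a Riesz-mean Perron integral
of order `k` to the left, applies (eq:FE), and is left with the kernels
`I_k(t) = ±3 (1/2πi) ∫_{(c)} (Δ^±(s)/Δ^±(1 − s)) (Γ(1 − s)/Γ(k + 2 − s)) t^{k+1−s} ds`. For `k = 3`,
`Γ(1 − s)/Γ(5 − s) = 1/((1 − s)(2 − s)(3 − s)(4 − s))`, and this file supplies the analytic facts about

* `ShintaniGamma.delta ε s` — **`Δ^ε(s)`** (`ε = 1`: `Δ⁺`, `ε = -1`: `Δ⁻`), holomorphic and non-vanishing on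
  `Re s > 1/6` (`differentiableOn_delta`, `delta_ne_zero`);
* `ShintaniGamma.deltaDualInv ε s` — the ENTIRE function `1/(Δ^ε(1 − s)(1 − s)(2 − s)(3 − s)(4 − s))`
  (the poles of `Γ((1−s)/2)`, `Γ((2−s)/2)` at `s = 1, 3` and `s = 2, 4` cancel the polynomial:
  `1/((1−s)(3−s)Γ((1−s)/2)) = 1/(4Γ((5−s)/2))`, `1/((2−s)(4−s)Γ((2−s)/2)) = 1/(4Γ((6−s)/2))`; written with
  Mathlib's entire `1/Γ`, `differentiable_deltaDualInv`, and equal to the displayed reciprocal off `{1,2,3,4}`,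
  `deltaDualInv_eq`);
* `ShintaniGamma.kernelG ε s := 6 Δ^ε(s) · deltaDualInv ε s` — **the kernel `G^ε(s)`** of the `k = 3` Landau
  argument, holomorphic on `Re s > 1/6` (`differentiableOn_kernelG`), with the two VERTICAL BOUNDS
  `‖G^ε(σ + it)‖ ≤ C |t|^{4σ−6}` for `|t| ≥ 2` and `‖G^ε(σ + it)‖ ≤ C` for `|t| ≤ 2`, uniformly for `σ` in a
  compact sub-interval of `(1/6, ∞)` (`exists_norm_kernelG_le_of_two_le`, `exists_norm_kernelG_le_of_abs_le_two`),
  combined as `‖G^ε(σ + it)‖ ≤ C (1 + |t|)^{4σ−6}` (`exists_norm_kernelG_le`).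

The bounds are Stirling's formula on vertical lines in its two-sided sharp form (the tree's
`GammaStirling.exists_norm_Gamma_vertical_le/ge`): the four factors `e^{−π|t|/4}` of `Δ^ε(σ + it)` cancel
against the four factors `e^{+π|t|/4}` of `1/Δ^ε(1 − σ − it)`, and the powers of `|t|` add up to
`Σ_ν (σ/2 + β_ν) − Σ_ν ((1−σ)/2 + β_ν) − 4 = 4σ − 6` ([LDTT] (eq:gamma_asym): `G(s) ≍ |Im s|^{2Aσ − Aδ − (k+1)}`
with `A = 2`, `δ = 1`, `k = 3`). Everything here is PROVED; the only definitions are the three displayed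
functions (no named facts).

## References

* M. Bhargava, T. Taniguchi, F. Thorne, *Improved error estimates for the Davenport–Heilbronn theorems*,
  Math. Ann. 389 (2024) = arXiv:2107.12819, §2.4 (the factors `Δ^±`, (eq:FE)) and §3 (proof of Thm 3.1,
  the kernel `I_k`). [BhargavaTaniguchiThorne2023]
* D. Lowry-Duda, T. Taniguchi, F. Thorne, *Uniform bounds for lattice point counting and partial sums of
  zeta functions*, Math. Z. 300 (2022) = arXiv:1710.02190, §2.2–2.3 ((eq:Idef), (eq:gamma_asym)).
  [LowrydudaTaniguchiThorne2017]
-/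

noncomputable section

open Complex Real Set Filter Topology

namespace Literature.NumberTheory.CubicFields

namespace ShintaniGamma

open Literature.Analysis.SpecialFunctions

/-! ### The factors `Δ^±(s)` -/

/-- BTT's constant `2⁴3⁶/π⁴` in `Δ^±(s) = (2⁴3⁶/π⁴)^{s/2} ∏ Γ(s/2 + β_ν)`. [cite: BhargavaTaniguchiThorne2023, §2.4 (definition of Δ^±)] -/
def deltaConst : ℝ := 2 ^ 4 * 3 ^ 6 / Real.pi ^ 4

/-- `2⁴3⁶/π⁴ > 0`. [folklore] -/
theorem deltaConst_pos : 0 < deltaConst := by unfold deltaConst; positivity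

/-- The third shift `β₃`: `−1/12` for `Δ⁺`, `5/12` for `Δ⁻`. [cite: BhargavaTaniguchiThorne2023, §2.4 (definition of Δ^±)] -/
def shift₃ (ε : ℤ) : ℝ := if ε = 1 then -1 / 12 else 5 / 12

/-- The fourth shift `β₄`: `1/12` for `Δ⁺`, `7/12` for `Δ⁻`. [cite: BhargavaTaniguchiThorne2023, §2.4 (definition of Δ^±)] -/
def shift₄ (ε : ℤ) : ℝ := if ε = 1 then 1 / 12 else 7 / 12

/-- `β₃ ∈ [−1/12, 7/12]`. [folklore] -/
theorem shift₃_mem (ε : ℤ) : shift₃ ε ∈ Icc (-1 / 12 : ℝ) (7 / 12) := by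
  unfold shift₃; split_ifs <;> constructor <;> norm_num

/-- `β₄ ∈ [−1/12, 7/12]`. [folklore] -/
theorem shift₄_mem (ε : ℤ) : shift₄ ε ∈ Icc (-1 / 12 : ℝ) (7 / 12) := by
  unfold shift₄; split_ifs <;> constructor <;> norm_num

/-- **`Δ^ε(s) = (2⁴3⁶/π⁴)^{s/2} Γ(s/2) Γ(s/2 + 1/2) Γ(s/2 + β₃) Γ(s/2 + β₄)`** (`ε = 1`: `Δ⁺`, `(β₃, β₄) = (−1/12, 1/12)`;
otherwise `Δ⁻`, `(β₃, β₄) = (5/12, 7/12)`). [cite: BhargavaTaniguchiThorne2023, §2.4 (definition of Δ^±)] -/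
def delta (ε : ℤ) (s : ℂ) : ℂ :=
  (deltaConst : ℂ) ^ (s / 2) *
    (Gamma (s / 2) * Gamma (s / 2 + 1 / 2) * Gamma (s / 2 + shift₃ ε) * Gamma (s / 2 + shift₄ ε))

/-- **`1/(Δ^ε(1 − s) (1 − s)(2 − s)(3 − s)(4 − s))` as an entire function**:
`(2⁴3⁶/π⁴)^{(s−1)/2} · (1/16) · 1/(Γ((5−s)/2) Γ((6−s)/2) Γ((1−s)/2 + β₃) Γ((1−s)/2 + β₄))`. [folklore] -/
def deltaDualInv (ε : ℤ) (s : ℂ) : ℂ :=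
  (deltaConst : ℂ) ^ ((s - 1) / 2) * (16 : ℂ)⁻¹ *
    ((Gamma ((5 - s) / 2))⁻¹ * (Gamma ((6 - s) / 2))⁻¹ * (Gamma ((1 - s) / 2 + shift₃ ε))⁻¹ *
      (Gamma ((1 - s) / 2 + shift₄ ε))⁻¹)

/-- **The Landau kernel `G^ε(s) = 6 Δ^ε(s)/(Δ^ε(1 − s)(1 − s)(2 − s)(3 − s)(4 − s))`** (`k = 3`:
`Γ(1 − s)/Γ(5 − s) = 1/((1 − s)⋯(4 − s))`, times `3! = 6`).
[cite: LowrydudaTaniguchiThorne2017, §2.2 (eq:Idef) (the kernel G(s) of I_k)] -/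
def kernelG (ε : ℤ) (s : ℂ) : ℂ := 6 * delta ε s * deltaDualInv ε s

/-! ### Holomorphy -/

/-- `Re (s/2 + β) > 0` for `Re s > 1/6` and `β ≥ −1/12`. [folklore] -/
theorem re_half_add_pos {s : ℂ} (hs : 1 / 6 < s.re) {β : ℝ} (hβ : -1 / 12 ≤ β) : 0 < (s / 2 + β).re := by
  simp only [add_re, ofReal_re, div_ofNat_re]
  linarith

/-- **`Δ^ε` is holomorphic on `Re s > 1/6`.** [folklore] -/
theorem differentiableOn_delta (ε : ℤ) : DifferentiableOn ℂ (delta ε) {s : ℂ | 1 / 6 < s.re} := by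
  intro s hs
  have hs : 1 / 6 < s.re := hs
  have hG : ∀ β : ℝ, -1 / 12 ≤ β → DifferentiableAt ℂ (fun z : ℂ => Gamma (z / 2 + β)) s := fun β hβ => by
    have hpos := re_half_add_pos hs hβ
    have h := differentiableAt_Gamma (s / 2 + β) (fun m hm => by
      rw [hm] at hpos; simp at hpos; linarith [(Nat.cast_nonneg m : (0 : ℝ) ≤ m)])
    exact h.comp s (by fun_prop)
  have h0 := hG 0 (by norm_num)
  simp only [ofReal_zero, add_zero] at h0
  have h12 := hG (1 / 2) (by norm_num)
  have h3 := hG (shift₃ ε) (shift₃_mem ε).1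
  have h4 := hG (shift₄ ε) (shift₄_mem ε).1
  have hc : DifferentiableAt ℂ (fun z : ℂ => (deltaConst : ℂ) ^ (z / 2)) s :=
    DifferentiableAt.const_cpow (by fun_prop) (Or.inl (by exact_mod_cast deltaConst_pos.ne'))
  have : DifferentiableAt ℂ (delta ε) s := by
    unfold delta
    push_cast at h12
    exact hc.mul (((h0.mul h12).mul h3).mul h4)
  exact this.differentiableWithinAt

/-- **`Δ^ε(s) ≠ 0` for `Re s > 1/6`.** [folklore] -/
theorem delta_ne_zero (ε : ℤ) {s : ℂ} (hs : 1 / 6 < s.re) : delta ε s ≠ 0 := by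
  unfold delta
  have hc : (deltaConst : ℂ) ^ (s / 2) ≠ 0 := by
    rw [Ne, cpow_eq_zero_iff, not_and_or]
    exact Or.inl (by exact_mod_cast deltaConst_pos.ne')
  have hG : ∀ β : ℝ, -1 / 12 ≤ β → Gamma (s / 2 + β) ≠ 0 := fun β hβ =>
    Gamma_ne_zero_of_re_pos (re_half_add_pos hs hβ)
  have h0 := hG 0 (by norm_num)
  simp only [ofReal_zero, add_zero] at h0
  have h12 := hG (1 / 2) (by norm_num)
  push_cast at h12
  exact mul_ne_zero hc (mul_ne_zero (mul_ne_zero (mul_ne_zero h0 h12) (hG _ (shift₃_mem ε).1))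
    (hG _ (shift₄_mem ε).1))

/-- **`deltaDualInv ε` is entire** (`1/Γ` is entire). [folklore] -/
theorem differentiable_deltaDualInv (ε : ℤ) : Differentiable ℂ (deltaDualInv ε) := by
  have hc : Differentiable ℂ (fun z : ℂ => (deltaConst : ℂ) ^ ((z - 1) / 2)) :=
    Differentiable.const_cpow (by fun_prop) (Or.inl (by exact_mod_cast deltaConst_pos.ne'))
  have h5 : Differentiable ℂ (fun z : ℂ => (Gamma ((5 - z) / 2))⁻¹) :=
    differentiable_one_div_Gamma.comp (by fun_prop)
  have h6 : Differentiable ℂ (fun z : ℂ => (Gamma ((6 - z) / 2))⁻¹) :=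
    differentiable_one_div_Gamma.comp (by fun_prop)
  have h3 : Differentiable ℂ (fun z : ℂ => (Gamma ((1 - z) / 2 + shift₃ ε))⁻¹) :=
    differentiable_one_div_Gamma.comp (by fun_prop)
  have h4 : Differentiable ℂ (fun z : ℂ => (Gamma ((1 - z) / 2 + shift₄ ε))⁻¹) :=
    differentiable_one_div_Gamma.comp (by fun_prop)
  unfold deltaDualInv
  exact (hc.mul (differentiable_const _)).mul (((h5.mul h6).mul h3).mul h4)

/-- **`G^ε` is holomorphic on `Re s > 1/6`.** [folklore] -/
theorem differentiableOn_kernelG (ε : ℤ) : DifferentiableOn ℂ (kernelG ε) {s : ℂ | 1 / 6 < s.re} := by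
  unfold kernelG
  exact ((differentiableOn_const _).mul (differentiableOn_delta ε)).mul
    (differentiable_deltaDualInv ε).differentiableOn

/-- `G^ε` is continuous on `Re s > 1/6`. [folklore] -/
theorem continuousOn_kernelG (ε : ℤ) : ContinuousOn (kernelG ε) {s : ℂ | 1 / 6 < s.re} :=
  (differentiableOn_kernelG ε).continuousOn

/-! ### `deltaDualInv` is the reciprocal of `Δ^ε(1 − s)(1 − s)(2 − s)(3 − s)(4 − s)` -/

/-- **`deltaDualInv ε s = (Δ^ε(1 − s) (1 − s)(2 − s)(3 − s)(4 − s))⁻¹` for `s ∉ {1, 2, 3, 4}`** (by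
`Γ(z + 2) = (z + 1) z Γ(z)` at `z = (1 − s)/2` and `z = (2 − s)/2`; at a pole of `Δ^ε(1 − s)` both sides are
Mathlib's `0`). [folklore] -/
theorem deltaDualInv_eq (ε : ℤ) {s : ℂ} (h1 : s ≠ 1) (h2 : s ≠ 2) (h3 : s ≠ 3) (h4 : s ≠ 4) :
    deltaDualInv ε s = (delta ε (1 - s) * ((1 - s) * (2 - s) * (3 - s) * (4 - s)))⁻¹ := by
  have e5 : Gamma ((5 - s) / 2) = (3 - s) / 2 * ((1 - s) / 2 * Gamma ((1 - s) / 2)) := by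
    have ha : (1 - s) / 2 ≠ 0 := by
      intro h; apply h1; linear_combination (-2 : ℂ) * h
    have hb : (1 - s) / 2 + 1 ≠ 0 := by
      intro h; apply h3; linear_combination (-2 : ℂ) * h
    rw [show (5 - s) / 2 = (1 - s) / 2 + 1 + 1 by ring, Gamma_add_one _ hb, Gamma_add_one _ ha]
    ring
  have e6 : Gamma ((6 - s) / 2) = (4 - s) / 2 * ((2 - s) / 2 * Gamma ((2 - s) / 2)) := by
    have ha : (2 - s) / 2 ≠ 0 := by
      intro h; apply h2; linear_combination (-2 : ℂ) * h
    have hb : (2 - s) / 2 + 1 ≠ 0 := by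
      intro h; apply h4; linear_combination (-2 : ℂ) * h
    rw [show (6 - s) / 2 = (2 - s) / 2 + 1 + 1 by ring, Gamma_add_one _ hb, Gamma_add_one _ ha]
    ring
  have ec : (deltaConst : ℂ) ^ ((s - 1) / 2) = ((deltaConst : ℂ) ^ ((1 - s) / 2))⁻¹ := by
    rw [← cpow_neg]; congr 1; ring
  have e2 : (1 - s) / 2 + 1 / 2 = (2 - s) / 2 := by ring
  unfold deltaDualInv delta
  rw [e5, e6, ec, e2]
  simp only [div_eq_mul_inv, mul_inv, inv_inv]
  ring

/-- **`G^ε(s) = 6 Δ^ε(s)/(Δ^ε(1 − s)(1 − s)(2 − s)(3 − s)(4 − s))` for `s ∉ {1, 2, 3, 4}`.**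
[cite: LowrydudaTaniguchiThorne2017, §2.2 (eq:Idef) (G = Γ(δ−s)/Γ(k+1+δ−s) · Δ(s)/Δ(δ−s))] -/
theorem kernelG_eq (ε : ℤ) {s : ℂ} (h1 : s ≠ 1) (h2 : s ≠ 2) (h3 : s ≠ 3) (h4 : s ≠ 4) :
    kernelG ε s = 6 * delta ε s / (delta ε (1 - s) * ((1 - s) * (2 - s) * (3 - s) * (4 - s))) := by
  rw [kernelG, deltaDualInv_eq ε h1 h2 h3 h4, div_eq_mul_inv]

/-! ### Vertical bounds: `‖G^ε(σ + it)‖ ≍ |t|^{4σ − 6}` -/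

/-- `(σ + it)/2 + β = (σ/2 + β) + (t/2) i` with real and imaginary parts displayed. [folklore] -/
theorem half_add_eq (σ t β : ℝ) :
    ((σ : ℂ) + t * I) / 2 + β = ((σ / 2 + β : ℝ) : ℂ) + ((t / 2 : ℝ) : ℂ) * I := by
  push_cast; ring

/-- `(c − (σ + it))/2 + β = ((c − σ)/2 + β) + (−t/2) i`. [folklore] -/
theorem half_sub_add_eq (c σ t β : ℝ) :
    ((c : ℂ) - ((σ : ℂ) + t * I)) / 2 + β = (((c - σ) / 2 + β : ℝ) : ℂ) + ((-(t / 2) : ℝ) : ℂ) * I := by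
  push_cast; ring

/-- `‖(C : ℂ)^{z}‖ = C^{Re z}` for the positive constant. [folklore] -/
theorem norm_deltaConst_cpow (z : ℂ) : ‖(deltaConst : ℂ) ^ z‖ = deltaConst ^ z.re :=
  norm_cpow_eq_rpow_re_of_pos deltaConst_pos z

/-- **Upper bound for `|t| ≥ 2`: `‖G^ε(σ + it)‖ ≤ C |t|^{4σ − 6}`**, uniformly for `σ ∈ [σ₁, σ₂]` (any reals)
and both `ε = ±1` — two-sided vertical Stirling, the exponentials `e^{∓π|t|}` cancelling.
[cite: LowrydudaTaniguchiThorne2017, §2.3 (eq:gamma_asym) (G(s) ≍ |Im s|^{2Aσ − Aδ − (k+1)})] -/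
theorem exists_norm_kernelG_le_of_two_le (σ₁ σ₂ : ℝ) :
    ∃ C : ℝ, 0 < C ∧ ∀ ε : ℤ, ∀ σ ∈ Icc σ₁ σ₂, ∀ t : ℝ, 2 ≤ |t| →
      ‖kernelG ε ((σ : ℂ) + t * I)‖ ≤ C * |t| ^ (4 * σ - 6) := by
  -- Stirling, upper, for the numerator arguments `σ/2 + β`, `β ∈ [−1/12, 7/12]`
  obtain ⟨Cu, hCu, hU⟩ := GammaStirling.exists_norm_Gamma_vertical_le (σ₁ / 2 - 1 / 12) (σ₂ / 2 + 7 / 12)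
  -- Stirling, lower, for the denominator arguments `(c − σ)/2 + β`, `c ∈ {1, 5, 6}`
  obtain ⟨cl, hcl, hL⟩ :=
    GammaStirling.exists_norm_Gamma_vertical_ge ((1 - σ₂) / 2 - 1 / 12) ((6 - σ₁) / 2 + 7 / 12)
  -- the constant factor `K^{σ − 1/2}` is bounded on `[σ₁, σ₂]`
  set K : ℝ := deltaConst with hK
  have hK0 : 0 < K := deltaConst_pos
  set M : ℝ := max (K ^ (σ₁ - 1 / 2)) (K ^ (σ₂ - 1 / 2)) with hM
  have hM0 : 0 < M := lt_max_of_lt_left (Real.rpow_pos_of_pos hK0 _)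
  -- `|t/2|^{4σ−6} = 2^{6−4σ} |t|^{4σ−6}` and `2^{6−4σ} ≤ P := 2^{6+4|σ₁|+4|σ₂|}`
  set P : ℝ := (2 : ℝ) ^ (6 + 4 * |σ₁| + 4 * |σ₂|) with hP
  have hP0 : 0 < P := Real.rpow_pos_of_pos two_pos _
  refine ⟨6 * M * 16⁻¹ * Cu ^ 4 * cl⁻¹ ^ 4 * P, by positivity, fun ε σ hσ t ht => ?_⟩
  have htabs : |t / 2| = |t| / 2 := by rw [abs_div, abs_of_pos (two_pos : (0 : ℝ) < 2)]
  have ht1 : 1 ≤ |t / 2| := by rw [htabs]; linarith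
  have ht0 : 0 < |t| := by linarith
  have hu0 : 0 < |t / 2| := by linarith
  set u : ℝ := |t / 2| with hu
  set E : ℝ := Real.exp (-(π * u) / 2) with hE
  have hE0 : 0 < E := Real.exp_pos _
  -- the four upper bounds `‖Γ(s/2 + β)‖ ≤ Cu u^{σ/2+β−1/2} E`
  have hup : ∀ β : ℝ, β ∈ Icc (-1 / 12 : ℝ) (7 / 12) →
      ‖Gamma (((σ : ℂ) + t * I) / 2 + β)‖ ≤ Cu * u ^ (σ / 2 + β - 1 / 2) * E := by
    intro β hβ
    rw [half_add_eq]
    exact hU (σ / 2 + β) ⟨by linarith [hσ.1, hβ.1], by linarith [hσ.2, hβ.2]⟩ (t / 2) ht1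
  -- the four lower bounds, as upper bounds `‖Γ((c − s)/2 + β)‖⁻¹ ≤ cl⁻¹ u^{−((c−σ)/2+β−1/2)} E⁻¹`
  have hlo : ∀ c β : ℝ, (1 - σ₂) / 2 - 1 / 12 ≤ (c - σ₂) / 2 + β → (c - σ₁) / 2 + β ≤ (6 - σ₁) / 2 + 7 / 12 →
      ‖(Gamma (((c : ℂ) - ((σ : ℂ) + t * I)) / 2 + β))⁻¹‖ ≤
        cl⁻¹ * u ^ (-((c - σ) / 2 + β - 1 / 2)) * E⁻¹ := by
    intro c β hc1 hc2
    rw [half_sub_add_eq, norm_inv]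
    have hx : (c - σ) / 2 + β ∈ Icc ((1 - σ₂) / 2 - 1 / 12) ((6 - σ₁) / 2 + 7 / 12) :=
      ⟨by linarith [hσ.2], by linarith [hσ.1]⟩
    have h := hL ((c - σ) / 2 + β) hx (-(t / 2)) (by rw [abs_neg]; exact ht1)
    rw [abs_neg] at h
    have hpos : 0 < cl * u ^ ((c - σ) / 2 + β - 1 / 2) * E := by positivity
    have hA : u ^ (-((c - σ) / 2 + β - 1 / 2)) = (u ^ ((c - σ) / 2 + β - 1 / 2))⁻¹ := Real.rpow_neg hu0.le _
    rw [hA, ← mul_inv, ← mul_inv]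
    exact inv_anti₀ hpos h
  -- the eight bounds in the syntactic forms of `delta`, `deltaDualInv`
  have hG0 : ‖Gamma (((σ : ℂ) + t * I) / 2)‖ ≤ Cu * u ^ (σ / 2 - 1 / 2) * E := by
    simpa using hup 0 ⟨by norm_num, by norm_num⟩
  have hG12 : ‖Gamma (((σ : ℂ) + t * I) / 2 + 1 / 2)‖ ≤ Cu * u ^ (σ / 2) * E := by
    simpa using hup (1 / 2) ⟨by norm_num, by norm_num⟩
  have hG3 : ‖Gamma (((σ : ℂ) + t * I) / 2 + shift₃ ε)‖ ≤ Cu * u ^ (σ / 2 + shift₃ ε - 1 / 2) * E :=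
    hup (shift₃ ε) (shift₃_mem ε)
  have hG4 : ‖Gamma (((σ : ℂ) + t * I) / 2 + shift₄ ε)‖ ≤ Cu * u ^ (σ / 2 + shift₄ ε - 1 / 2) * E :=
    hup (shift₄ ε) (shift₄_mem ε)
  have hI5 : ‖(Gamma (((5 : ℂ) - ((σ : ℂ) + t * I)) / 2))⁻¹‖ ≤ cl⁻¹ * u ^ (-((5 - σ) / 2 - 1 / 2)) * E⁻¹ := by
    simpa using hlo 5 0 (by linarith) (by linarith)
  have hI6 : ‖(Gamma (((6 : ℂ) - ((σ : ℂ) + t * I)) / 2))⁻¹‖ ≤ cl⁻¹ * u ^ (-((6 - σ) / 2 - 1 / 2)) * E⁻¹ := by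
    simpa using hlo 6 0 (by linarith) (by linarith)
  have hI3 : ‖(Gamma (((1 : ℂ) - ((σ : ℂ) + t * I)) / 2 + shift₃ ε))⁻¹‖ ≤
      cl⁻¹ * u ^ (-((1 - σ) / 2 + shift₃ ε - 1 / 2)) * E⁻¹ := by
    simpa using hlo 1 (shift₃ ε) (by linarith [(shift₃_mem ε).1]) (by linarith [(shift₃_mem ε).2])
  have hI4 : ‖(Gamma (((1 : ℂ) - ((σ : ℂ) + t * I)) / 2 + shift₄ ε))⁻¹‖ ≤
      cl⁻¹ * u ^ (-((1 - σ) / 2 + shift₄ ε - 1 / 2)) * E⁻¹ := by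
    simpa using hlo 1 (shift₄ ε) (by linarith [(shift₄_mem ε).1]) (by linarith [(shift₄_mem ε).2])
  -- norms of the constant powers
  have hc1 : ‖(deltaConst : ℂ) ^ (((σ : ℂ) + t * I) / 2)‖ = K ^ (σ / 2) := by
    rw [norm_deltaConst_cpow]; congr 1; simp
  have hc2 : ‖(deltaConst : ℂ) ^ ((((σ : ℂ) + t * I) - 1) / 2)‖ = K ^ ((σ - 1) / 2) := by
    rw [norm_deltaConst_cpow]; congr 1; simp
  have h16 : ‖(16 : ℂ)⁻¹‖ = 16⁻¹ := by simp
  have hKσ : K ^ (σ / 2) * K ^ ((σ - 1) / 2) ≤ M := by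
    rw [← Real.rpow_add hK0, show σ / 2 + (σ - 1) / 2 = σ - 1 / 2 by ring]
    rcases le_total 1 K with hK1 | hK1
    · exact (Real.rpow_le_rpow_of_exponent_le hK1 (by linarith [hσ.2])).trans (le_max_right _ _)
    · exact (Real.rpow_le_rpow_of_exponent_ge hK0 hK1 (by linarith [hσ.1])).trans (le_max_left _ _)
  -- the numerator and the denominator
  have hnum : ‖delta ε ((σ : ℂ) + t * I)‖ ≤ K ^ (σ / 2) *
      ((Cu * u ^ (σ / 2 - 1 / 2) * E) * (Cu * u ^ (σ / 2) * E) *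
        (Cu * u ^ (σ / 2 + shift₃ ε - 1 / 2) * E) * (Cu * u ^ (σ / 2 + shift₄ ε - 1 / 2) * E)) := by
    unfold delta
    rw [norm_mul, hc1, norm_mul, norm_mul, norm_mul]
    refine mul_le_mul_of_nonneg_left ?_ (by positivity)
    exact mul_le_mul (mul_le_mul (mul_le_mul hG0 hG12 (norm_nonneg _) (by positivity)) hG3 (norm_nonneg _)
      (by positivity)) hG4 (norm_nonneg _) (by positivity)
  have hden : ‖deltaDualInv ε ((σ : ℂ) + t * I)‖ ≤ K ^ ((σ - 1) / 2) * 16⁻¹ *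
      ((cl⁻¹ * u ^ (-((5 - σ) / 2 - 1 / 2)) * E⁻¹) * (cl⁻¹ * u ^ (-((6 - σ) / 2 - 1 / 2)) * E⁻¹) *
        (cl⁻¹ * u ^ (-((1 - σ) / 2 + shift₃ ε - 1 / 2)) * E⁻¹) *
        (cl⁻¹ * u ^ (-((1 - σ) / 2 + shift₄ ε - 1 / 2)) * E⁻¹)) := by
    unfold deltaDualInv
    rw [norm_mul, norm_mul, hc2, h16, norm_mul, norm_mul, norm_mul]
    refine mul_le_mul_of_nonneg_left ?_ (by positivity)
    exact mul_le_mul (mul_le_mul (mul_le_mul hI5 hI6 (norm_nonneg _) (by positivity)) hI3 (norm_nonneg _)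
      (by positivity)) hI4 (norm_nonneg _) (by positivity)
  -- the product of the two right-hand sides
  have hprod : K ^ (σ / 2) *
      ((Cu * u ^ (σ / 2 - 1 / 2) * E) * (Cu * u ^ (σ / 2) * E) *
        (Cu * u ^ (σ / 2 + shift₃ ε - 1 / 2) * E) * (Cu * u ^ (σ / 2 + shift₄ ε - 1 / 2) * E)) *
      (K ^ ((σ - 1) / 2) * 16⁻¹ *
      ((cl⁻¹ * u ^ (-((5 - σ) / 2 - 1 / 2)) * E⁻¹) * (cl⁻¹ * u ^ (-((6 - σ) / 2 - 1 / 2)) * E⁻¹) *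
        (cl⁻¹ * u ^ (-((1 - σ) / 2 + shift₃ ε - 1 / 2)) * E⁻¹) *
        (cl⁻¹ * u ^ (-((1 - σ) / 2 + shift₄ ε - 1 / 2)) * E⁻¹)))
      = (K ^ (σ / 2) * K ^ ((σ - 1) / 2)) * 16⁻¹ * Cu ^ 4 * cl⁻¹ ^ 4 * u ^ (4 * σ - 6) := by
    have hEE : E * E⁻¹ = 1 := mul_inv_cancel₀ hE0.ne'
    have hT : u ^ (σ / 2 - 1 / 2) * u ^ (σ / 2) * u ^ (σ / 2 + shift₃ ε - 1 / 2) * u ^ (σ / 2 + shift₄ ε - 1 / 2) *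
        (u ^ (-((5 - σ) / 2 - 1 / 2)) * u ^ (-((6 - σ) / 2 - 1 / 2)) *
          u ^ (-((1 - σ) / 2 + shift₃ ε - 1 / 2)) * u ^ (-((1 - σ) / 2 + shift₄ ε - 1 / 2))) =
        u ^ (4 * σ - 6) := by
      simp only [← Real.rpow_add hu0]
      congr 1; ring
    calc _ = (K ^ (σ / 2) * K ^ ((σ - 1) / 2)) * 16⁻¹ * Cu ^ 4 * cl⁻¹ ^ 4 *
          (u ^ (σ / 2 - 1 / 2) * u ^ (σ / 2) * u ^ (σ / 2 + shift₃ ε - 1 / 2) * u ^ (σ / 2 + shift₄ ε - 1 / 2) *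
            (u ^ (-((5 - σ) / 2 - 1 / 2)) * u ^ (-((6 - σ) / 2 - 1 / 2)) *
              u ^ (-((1 - σ) / 2 + shift₃ ε - 1 / 2)) * u ^ (-((1 - σ) / 2 + shift₄ ε - 1 / 2)))) *
          (E * E⁻¹) ^ 4 := by ring
      _ = _ := by rw [hT, hEE]; ring
  -- `u^{4σ−6} ≤ P |t|^{4σ−6}`
  have htwo : u ^ (4 * σ - 6) ≤ P * |t| ^ (4 * σ - 6) := by
    rw [htabs, Real.div_rpow (abs_nonneg t) zero_le_two, div_eq_mul_inv, mul_comm]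
    refine mul_le_mul_of_nonneg_right ?_ (by positivity)
    rw [← Real.rpow_neg zero_le_two, hP]
    refine Real.rpow_le_rpow_of_exponent_le one_le_two ?_
    have h2 : |σ| ≤ |σ₁| + |σ₂| := by
      rcases le_total 0 σ with h | h
      · rw [abs_of_nonneg h]; linarith [hσ.2, le_abs_self σ₂, abs_nonneg σ₁]
      · rw [abs_of_nonpos h]; linarith [hσ.1, neg_le_abs σ₁, abs_nonneg σ₂]
    linarith [abs_nonneg σ₁, abs_nonneg σ₂, neg_le_abs σ, le_abs_self σ]
  calc ‖kernelG ε ((σ : ℂ) + t * I)‖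
      = 6 * (‖delta ε ((σ : ℂ) + t * I)‖ * ‖deltaDualInv ε ((σ : ℂ) + t * I)‖) := by
        rw [kernelG, norm_mul, norm_mul]; simp [mul_assoc]
    _ ≤ 6 * ((K ^ (σ / 2) * K ^ ((σ - 1) / 2)) * 16⁻¹ * Cu ^ 4 * cl⁻¹ ^ 4 * u ^ (4 * σ - 6)) := by
        rw [← hprod]
        exact mul_le_mul_of_nonneg_left (mul_le_mul hnum hden (norm_nonneg _) (by positivity)) (by norm_num)
    _ ≤ 6 * (M * 16⁻¹ * Cu ^ 4 * cl⁻¹ ^ 4 * (P * |t| ^ (4 * σ - 6))) := by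
        gcongr
    _ = 6 * M * 16⁻¹ * Cu ^ 4 * cl⁻¹ ^ 4 * P * |t| ^ (4 * σ - 6) := by ring

/-- `x^e ≤ 3^N (1 + x)^e` for `x ≥ 1`, `|e| ≤ N`. [folklore] -/
theorem rpow_le_three_rpow_mul {x e N : ℝ} (hx : 1 ≤ x) (he : |e| ≤ N) : x ^ e ≤ 3 ^ N * (1 + x) ^ e := by
  have hx0 : 0 < x := by linarith
  have h3N : 1 ≤ (3 : ℝ) ^ N := Real.one_le_rpow (by norm_num) ((abs_nonneg e).trans he)
  rcases le_or_gt 0 e with he0 | he0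
  · calc x ^ e ≤ (1 + x) ^ e := Real.rpow_le_rpow hx0.le (by linarith) he0
      _ = 1 * (1 + x) ^ e := (one_mul _).symm
      _ ≤ 3 ^ N * (1 + x) ^ e := mul_le_mul_of_nonneg_right h3N (by positivity)
  · have h1 : x ^ e ≤ ((1 + x) / 2) ^ e := Real.rpow_le_rpow_of_nonpos (by positivity) (by linarith) he0.le
    have h2 : ((1 + x) / 2) ^ e = (1 + x) ^ e * 2 ^ (-e) := by
      rw [Real.div_rpow (by positivity) zero_le_two, Real.rpow_neg zero_le_two, div_eq_mul_inv]
    have h3 : (2 : ℝ) ^ (-e) ≤ 3 ^ N :=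
      (Real.rpow_le_rpow zero_le_two (by norm_num) (by linarith)).trans
        (Real.rpow_le_rpow_of_exponent_le (by norm_num) ((neg_le_abs e).trans he))
    calc x ^ e ≤ (1 + x) ^ e * 2 ^ (-e) := h1.trans h2.le
      _ ≤ (1 + x) ^ e * 3 ^ N := mul_le_mul_of_nonneg_left h3 (by positivity)
      _ = 3 ^ N * (1 + x) ^ e := mul_comm _ _

/-- `1 ≤ 3^N (1 + x)^e` for `0 ≤ x ≤ 2`, `|e| ≤ N`. [folklore] -/
theorem one_le_three_rpow_mul {x e N : ℝ} (hx0 : 0 ≤ x) (hx : x ≤ 2) (he : |e| ≤ N) : 1 ≤ 3 ^ N * (1 + x) ^ e := by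
  have h3N : 1 ≤ (3 : ℝ) ^ N := Real.one_le_rpow (by norm_num) ((abs_nonneg e).trans he)
  rcases le_or_gt 0 e with he0 | he0
  · have h1 : 1 ≤ (1 + x) ^ e := Real.one_le_rpow (by linarith) he0
    nlinarith
  · have h1 : (3 : ℝ) ^ e ≤ (1 + x) ^ e := Real.rpow_le_rpow_of_nonpos (by positivity) (by linarith) he0.le
    have h2 : (1 : ℝ) ≤ 3 ^ N * 3 ^ e := by
      rw [← Real.rpow_add (by norm_num)]
      exact Real.one_le_rpow (by norm_num) (by linarith [neg_abs_le e])
    exact h2.trans (mul_le_mul_of_nonneg_left h1 (by positivity))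

/-- `|4σ − 6| ≤ 6 + 4|σ₁| + 4|σ₂|` for `σ ∈ [σ₁, σ₂]`. [folklore] -/
theorem abs_exponent_le {σ₁ σ₂ σ : ℝ} (hσ : σ ∈ Icc σ₁ σ₂) : |4 * σ - 6| ≤ 6 + 4 * |σ₁| + 4 * |σ₂| := by
  have h2 : |σ| ≤ |σ₁| + |σ₂| := by
    rcases le_total 0 σ with h | h
    · rw [abs_of_nonneg h]; linarith [hσ.2, le_abs_self σ₂, abs_nonneg σ₁]
    · rw [abs_of_nonpos h]; linarith [hσ.1, neg_le_abs σ₁, abs_nonneg σ₂]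
  rw [abs_le]
  constructor <;> linarith [abs_nonneg σ₁, abs_nonneg σ₂, neg_le_abs σ, le_abs_self σ, neg_abs_le σ]

/-- **Bound for `|t| ≤ 2`: `‖G^ε(σ + it)‖ ≤ C`** uniformly for `σ ∈ [σ₁, σ₂] ⊂ (1/6, ∞)` and `ε = ±1`
(`G^ε` is continuous on the compact rectangle, being holomorphic on `Re s > 1/6`). [folklore] -/
theorem exists_norm_kernelG_le_of_abs_le_two {σ₁ σ₂ : ℝ} (h₁ : 1 / 6 < σ₁) :
    ∃ C : ℝ, 0 < C ∧ ∀ ε : ℤ, (ε = 1 ∨ ε = -1) → ∀ σ ∈ Icc σ₁ σ₂, ∀ t : ℝ, |t| ≤ 2 →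
      ‖kernelG ε ((σ : ℂ) + t * I)‖ ≤ C := by
  have hR : IsCompact (Icc σ₁ σ₂ ×ℂ Icc (-2 : ℝ) 2) :=
    Metric.isCompact_of_isClosed_isBounded (isClosed_Icc.reProdIm isClosed_Icc)
      ((Metric.isBounded_Icc _ _).reProdIm (Metric.isBounded_Icc _ _))
  have hsub : Icc σ₁ σ₂ ×ℂ Icc (-2 : ℝ) 2 ⊆ {s : ℂ | 1 / 6 < s.re} := fun s hs => lt_of_lt_of_le h₁ hs.1.1
  have hb : ∀ ε : ℤ, ∃ C, ∀ s ∈ Icc σ₁ σ₂ ×ℂ Icc (-2 : ℝ) 2, ‖kernelG ε s‖ ≤ C := fun ε =>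
    hR.exists_bound_of_continuousOn ((continuousOn_kernelG ε).mono hsub)
  obtain ⟨C₁, hC₁⟩ := hb 1
  obtain ⟨C₂, hC₂⟩ := hb (-1)
  refine ⟨max (max C₁ C₂) 1, lt_max_of_lt_right one_pos, fun ε hε σ hσ t ht => ?_⟩
  have hmem : ((σ : ℂ) + t * I) ∈ Icc σ₁ σ₂ ×ℂ Icc (-2 : ℝ) 2 := by
    refine ⟨?_, ?_⟩
    · simpa using hσ
    · simpa using abs_le.mp ht
  rcases hε with rfl | rfl
  · exact (hC₁ _ hmem).trans ((le_max_left _ _).trans (le_max_left _ _))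
  · exact (hC₂ _ hmem).trans ((le_max_right _ _).trans (le_max_left _ _))

/-- **`‖G^ε(σ + it)‖ ≤ C (1 + |t|)^{4σ − 6}` for every real `t`**, uniformly for `σ ∈ [σ₁, σ₂] ⊂ (1/6, ∞)` and
`ε = ±1` — in particular `G^ε` is absolutely integrable on `Re s = σ` exactly when `σ < 5/4`, and `|s|³ G^ε(s)`
when `σ < 1/2` (the two lines of the Bessel-free Landau argument).
[cite: LowrydudaTaniguchiThorne2017, §2.3 (eq:gamma_asym) (G(s) ≍ |Im s|^{2Aσ − Aδ − (k+1)}, A = 2, δ = 1, k = 3)] -/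
theorem exists_norm_kernelG_le {σ₁ σ₂ : ℝ} (h₁ : 1 / 6 < σ₁) :
    ∃ C : ℝ, 0 < C ∧ ∀ ε : ℤ, (ε = 1 ∨ ε = -1) → ∀ σ ∈ Icc σ₁ σ₂, ∀ t : ℝ,
      ‖kernelG ε ((σ : ℂ) + t * I)‖ ≤ C * (1 + |t|) ^ (4 * σ - 6) := by
  obtain ⟨C₁, hC₁, hA⟩ := exists_norm_kernelG_le_of_two_le σ₁ σ₂
  obtain ⟨C₂, hC₂, hB⟩ := exists_norm_kernelG_le_of_abs_le_two (σ₂ := σ₂) h₁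
  set N : ℝ := 6 + 4 * |σ₁| + 4 * |σ₂| with hN
  refine ⟨max C₁ C₂ * 3 ^ N, by positivity, fun ε hε σ hσ t => ?_⟩
  have he : |4 * σ - 6| ≤ N := abs_exponent_le hσ
  have hpos : 0 ≤ (1 + |t|) ^ (4 * σ - 6) := by positivity
  rcases le_or_gt 2 |t| with ht | ht
  · calc ‖kernelG ε ((σ : ℂ) + t * I)‖ ≤ C₁ * |t| ^ (4 * σ - 6) := hA ε σ hσ t ht
      _ ≤ C₁ * (3 ^ N * (1 + |t|) ^ (4 * σ - 6)) :=
          mul_le_mul_of_nonneg_left (rpow_le_three_rpow_mul (by linarith) he) hC₁.le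
      _ ≤ max C₁ C₂ * (3 ^ N * (1 + |t|) ^ (4 * σ - 6)) :=
          mul_le_mul_of_nonneg_right (le_max_left _ _) (by positivity)
      _ = max C₁ C₂ * 3 ^ N * (1 + |t|) ^ (4 * σ - 6) := by ring
  · calc ‖kernelG ε ((σ : ℂ) + t * I)‖ ≤ C₂ := hB ε hε σ hσ t ht.le
      _ = C₂ * 1 := (mul_one _).symm
      _ ≤ max C₁ C₂ * (3 ^ N * (1 + |t|) ^ (4 * σ - 6)) :=
          mul_le_mul (le_max_right _ _) (one_le_three_rpow_mul (abs_nonneg t) ht.le he) zero_le_one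
            (by positivity)
      _ = max C₁ C₂ * 3 ^ N * (1 + |t|) ^ (4 * σ - 6) := by ring

/-! ### No junk values on the strip `−1/6 < Re w < 0` (the left line of the Landau argument) -/

/-- `Γ(z) ≠ 0` as soon as `Re z` is not a nonpositive integer. [folklore] -/
theorem Gamma_ne_zero_of_re {z : ℂ} (hz : ∀ m : ℕ, z.re ≠ -m) : Gamma z ≠ 0 :=
  Complex.Gamma_ne_zero fun m h => hz m (by rw [h]; simp)

/-- `Γ` is differentiable at `z` as soon as `Re z` is not a nonpositive integer. [folklore] -/
theorem differentiableAt_Gamma_of_re {z : ℂ} (hz : ∀ m : ℕ, z.re ≠ -m) : DifferentiableAt ℂ Complex.Gamma z :=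
  Complex.differentiableAt_Gamma z fun m h => hz m (by rw [h]; simp)

/-- A real number in an open interval `(lo, hi)` with `−1 ≤ lo`, `hi ≤ 0` is not a nonpositive integer. [folklore] -/
theorem ne_neg_nat_of_mem_Ioo {x lo hi : ℝ} (hlo : -1 ≤ lo) (hhi : hi ≤ 0) (hx : x ∈ Ioo lo hi) (m : ℕ) :
    x ≠ -m := by
  rintro rfl
  rcases Nat.eq_zero_or_pos m with rfl | hm
  · simp at hx; linarith [hx.2]
  · have : (1 : ℝ) ≤ m := by exact_mod_cast hm
    linarith [hx.1]

/-- The four arguments `w/2 + β` of `Δ^ε(w)` avoid the poles of `Γ` when `−1/6 < Re w < 0`. [folklore] -/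
theorem half_add_shift_ne_neg_nat {w : ℂ} (hw : w.re ∈ Ioo (-1 / 6 : ℝ) 0) {β : ℝ}
    (hβ : β = 0 ∨ β = 1 / 2 ∨ β = -1 / 12 ∨ β = 1 / 12 ∨ β = 5 / 12 ∨ β = 7 / 12) (m : ℕ) :
    (w / 2 + β).re ≠ -m := by
  have hre : (w / 2 + (β : ℂ)).re = w.re / 2 + β := by simp
  rw [hre]
  obtain ⟨h1, h2⟩ := hw
  have hm0 : (0 : ℝ) ≤ m := Nat.cast_nonneg m
  rcases hβ with rfl | rfl | rfl | rfl | rfl | rfl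
  · exact ne_neg_nat_of_mem_Ioo (lo := -1 / 12) (hi := 0) (by norm_num) le_rfl ⟨by linarith, by linarith⟩ m
  · intro h; linarith
  · exact ne_neg_nat_of_mem_Ioo (lo := -1 / 6) (hi := -1 / 12) (by norm_num) (by norm_num)
      ⟨by linarith, by linarith⟩ m
  · intro h; linarith
  · intro h; linarith
  · intro h; linarith

/-- `β₃ ∈ {−1/12, 5/12}`. [folklore] -/
theorem shift₃_cases (ε : ℤ) : shift₃ ε = -1 / 12 ∨ shift₃ ε = 5 / 12 := by
  unfold shift₃; split_ifs <;> simp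

/-- `β₄ ∈ {1/12, 7/12}`. [folklore] -/
theorem shift₄_cases (ε : ℤ) : shift₄ ε = 1 / 12 ∨ shift₄ ε = 7 / 12 := by
  unfold shift₄; split_ifs <;> simp

/-- **`Δ^ε(w) ≠ 0` (no pole of `Γ`, hence no junk zero, and `Γ` never vanishes) for `−1/6 < Re w < 0`** — the
region of the left line `Re w = 1 − c'`, `c' ∈ (1, 7/6)`, of the Landau contour, where (eq:FE) is divided by
`Δ^ε(w)`. [folklore] -/
theorem delta_ne_zero_of_re_mem_Ioo (ε : ℤ) {w : ℂ} (hw : w.re ∈ Ioo (-1 / 6 : ℝ) 0) : delta ε w ≠ 0 := by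
  unfold delta
  have hc : (deltaConst : ℂ) ^ (w / 2) ≠ 0 := by
    rw [Ne, cpow_eq_zero_iff, not_and_or]
    exact Or.inl (by exact_mod_cast deltaConst_pos.ne')
  have h0 : Gamma (w / 2) ≠ 0 := by
    simpa using Gamma_ne_zero_of_re (half_add_shift_ne_neg_nat hw (β := 0) (Or.inl rfl))
  have h12 : Gamma (w / 2 + 1 / 2) ≠ 0 := by
    have := Gamma_ne_zero_of_re (half_add_shift_ne_neg_nat hw (β := 1 / 2) (Or.inr (Or.inl rfl)))
    push_cast at this
    exact this
  have h3 : Gamma (w / 2 + shift₃ ε) ≠ 0 := by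
    refine Gamma_ne_zero_of_re (half_add_shift_ne_neg_nat hw ?_)
    rcases shift₃_cases ε with h | h <;> simp [h]
  have h4 : Gamma (w / 2 + shift₄ ε) ≠ 0 := by
    refine Gamma_ne_zero_of_re (half_add_shift_ne_neg_nat hw ?_)
    rcases shift₄_cases ε with h | h <;> simp [h]
  exact mul_ne_zero hc (mul_ne_zero (mul_ne_zero (mul_ne_zero h0 h12) h3) h4)

/-- **`Δ^ε` is holomorphic on `−1/6 < Re w < 0`.** [folklore] -/
theorem differentiableOn_delta_left (ε : ℤ) : DifferentiableOn ℂ (delta ε) {w : ℂ | w.re ∈ Ioo (-1 / 6 : ℝ) 0} := by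
  intro w hw
  have hw : w.re ∈ Ioo (-1 / 6 : ℝ) 0 := hw
  have hG : ∀ β : ℝ, (β = 0 ∨ β = 1 / 2 ∨ β = -1 / 12 ∨ β = 1 / 12 ∨ β = 5 / 12 ∨ β = 7 / 12) →
      DifferentiableAt ℂ (fun z : ℂ => Gamma (z / 2 + β)) w := fun β hβ =>
    (differentiableAt_Gamma_of_re (half_add_shift_ne_neg_nat hw hβ)).comp w (by fun_prop)
  have h0 := hG 0 (Or.inl rfl)
  simp only [ofReal_zero, add_zero] at h0
  have h12 := hG (1 / 2) (Or.inr (Or.inl rfl))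
  push_cast at h12
  have h3 := hG (shift₃ ε) (by rcases shift₃_cases ε with h | h <;> simp [h])
  have h4 := hG (shift₄ ε) (by rcases shift₄_cases ε with h | h <;> simp [h])
  have hc : DifferentiableAt ℂ (fun z : ℂ => (deltaConst : ℂ) ^ (z / 2)) w :=
    DifferentiableAt.const_cpow (by fun_prop) (Or.inl (by exact_mod_cast deltaConst_pos.ne'))
  have : DifferentiableAt ℂ (delta ε) w := by
    unfold delta
    exact hc.mul (((h0.mul h12).mul h3).mul h4)
  exact this.differentiableWithinAt

/-! ### The ratio `Δ^ε(s)/Δ^ε(1 − s)` on vertical lines -/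

/-- `‖(k − s)‖ ≤ (5 + |σ₁| + |σ₂|)(1 + |t|)` for `s = σ + it`, `σ ∈ [σ₁, σ₂]`, `k ∈ [0, 4]`. [folklore] -/
theorem norm_sub_le_mul {σ₁ σ₂ σ : ℝ} (hσ : σ ∈ Icc σ₁ σ₂) (t : ℝ) {k : ℝ} (hk0 : 0 ≤ k) (hk : k ≤ 4) :
    ‖(k : ℂ) - ((σ : ℂ) + t * I)‖ ≤ (5 + |σ₁| + |σ₂|) * (1 + |t|) := by
  have h2 : |σ| ≤ |σ₁| + |σ₂| := by
    rcases le_total 0 σ with h | h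
    · rw [abs_of_nonneg h]; linarith [hσ.2, le_abs_self σ₂, abs_nonneg σ₁]
    · rw [abs_of_nonpos h]; linarith [hσ.1, neg_le_abs σ₁, abs_nonneg σ₂]
  calc ‖(k : ℂ) - ((σ : ℂ) + t * I)‖ ≤ ‖(k : ℂ)‖ + ‖(σ : ℂ) + t * I‖ := norm_sub_le _ _
    _ ≤ k + (|σ| + |t|) := by
        gcongr
        · rw [Complex.norm_real, Real.norm_eq_abs, abs_of_nonneg hk0]
        · calc ‖(σ : ℂ) + t * I‖ ≤ ‖(σ : ℂ)‖ + ‖(t : ℂ) * I‖ := norm_add_le _ _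
            _ = |σ| + |t| := by simp
    _ ≤ (5 + |σ₁| + |σ₂|) * (1 + |t|) := by
        nlinarith [abs_nonneg t, abs_nonneg σ₁, abs_nonneg σ₂, abs_nonneg σ]

/-- **`‖Δ^ε(s)/Δ^ε(1 − s)‖ ≤ C (1 + |t|)^{4σ − 2}`** for `s = σ + it`, uniformly for `σ ∈ [σ₁, σ₂] ⊂ (1/6, ∞)` and
`ε = ±1` (at the junk zeros `s ∈ {1, 2, 3, 4}` of Mathlib's `Δ^ε(1 − s)` the quotient is `0`; elsewhere it is
`G^ε(s)(1 − s)(2 − s)(3 − s)(4 − s)/6`). This is the growth of the right-hand side of (eq:FE) on vertical lines.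
[cite: LowrydudaTaniguchiThorne2017, §2.3 (eq:gamma_asym)] -/
theorem exists_norm_delta_div_le {σ₁ σ₂ : ℝ} (h₁ : 1 / 6 < σ₁) :
    ∃ C : ℝ, 0 < C ∧ ∀ ε : ℤ, (ε = 1 ∨ ε = -1) → ∀ σ ∈ Icc σ₁ σ₂, ∀ t : ℝ,
      ‖delta ε ((σ : ℂ) + t * I) / delta ε (1 - ((σ : ℂ) + t * I))‖ ≤ C * (1 + |t|) ^ (4 * σ - 2) := by
  obtain ⟨C, hC, hG⟩ := exists_norm_kernelG_le (σ₂ := σ₂) h₁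
  set A : ℝ := 5 + |σ₁| + |σ₂| with hA
  refine ⟨C * A ^ 4, by positivity, fun ε hε σ hσ t => ?_⟩
  set s : ℂ := (σ : ℂ) + t * I with hs
  have hpos : 0 < 1 + |t| := by positivity
  by_cases hjunk : s = 1 ∨ s = 2 ∨ s = 3 ∨ s = 4
  · -- `Δ^ε(1 − s)` is a junk `0`, the quotient vanishes
    have hzero : delta ε (1 - s) = 0 := by
      have hG0 : Complex.Gamma 0 = 0 := Complex.Gamma_zero
      have hG1 : Complex.Gamma (-1) = 0 := by simpa using Complex.Gamma_neg_nat_eq_zero 1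
      unfold delta
      rcases hjunk with h | h | h | h <;> rw [h] <;> norm_num [hG0, hG1]
    rw [hzero, div_zero, norm_zero]; positivity
  push Not at hjunk
  obtain ⟨hs1, hs2, hs3, hs4⟩ := hjunk
  have hG' := hG ε hε σ hσ t
  have key : delta ε s / delta ε (1 - s) = kernelG ε s * ((1 - s) * (2 - s) * (3 - s) * (4 - s)) / 6 := by
    rw [kernelG_eq ε hs1 hs2 hs3 hs4]
    have hΔ : delta ε s ≠ 0 := delta_ne_zero ε (by rw [hs]; simpa using lt_of_lt_of_le h₁ hσ.1)
    by_cases hz : delta ε (1 - s) = 0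
    · rw [hz]; simp
    · field_simp
  rw [key, norm_div, norm_mul, Complex.norm_ofNat]
  have hpoly : ‖(1 - s) * (2 - s) * (3 - s) * (4 - s)‖ ≤ (A * (1 + |t|)) ^ 4 := by
    rw [norm_mul, norm_mul, norm_mul, pow_succ, pow_succ, pow_succ, pow_one]
    have h1 := norm_sub_le_mul hσ t (k := 1) zero_le_one (by norm_num)
    have h2 := norm_sub_le_mul hσ t (k := 2) zero_le_two (by norm_num)
    have h3 := norm_sub_le_mul hσ t (k := 3) (by norm_num) (by norm_num)
    have h4 := norm_sub_le_mul hσ t (k := 4) (by norm_num) le_rfl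
    push_cast at h1 h2 h3 h4
    exact mul_le_mul (mul_le_mul (mul_le_mul h1 h2 (norm_nonneg _) (by positivity)) h3 (norm_nonneg _)
      (by positivity)) h4 (norm_nonneg _) (by positivity)
  have hexp : (1 + |t|) ^ (4 * σ - 6) * (1 + |t|) ^ (4 : ℕ) = (1 + |t|) ^ (4 * σ - 2) := by
    rw [← Real.rpow_natCast, ← Real.rpow_add hpos]; congr 1; push_cast; ring
  calc ‖kernelG ε s‖ * ‖(1 - s) * (2 - s) * (3 - s) * (4 - s)‖ / 6
      ≤ C * (1 + |t|) ^ (4 * σ - 6) * (A * (1 + |t|)) ^ 4 / 6 := by gcongr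
    _ = C * A ^ 4 * ((1 + |t|) ^ (4 * σ - 6) * (1 + |t|) ^ (4 : ℕ)) / 6 := by ring
    _ ≤ C * A ^ 4 * (1 + |t|) ^ (4 * σ - 2) := by
        rw [hexp]
        have : 0 ≤ C * A ^ 4 * (1 + |t|) ^ (4 * σ - 2) := by positivity
        linarith

end ShintaniGamma

end Literature.NumberTheory.CubicFields

end
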